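import Mathlib
import HarnessLib
import Literature.MathematicalPhysics.QuantumManyBody.PeriodicBoseGasFracEnergy
import Literature.MathematicalPhysics.QuantumManyBody.PeriodicKineticBudget
import Literature.MathematicalPhysics.QuantumManyBody.PeriodicBoseGasUpperBoundProofs
import Literature.Barriers.AtomisticToContinuum.KineticGapLengthScalesFreeGas
import Literature.MathematicalPhysics.QuantumManyBody.BoseGasThermodynamicLimitRuelle

/-!
# BlockLatticeFSum · residual `DeepInfraredEmptiness` (stmt-AtomisticToContinuum-27506) — PLANE-WAVE CARVING, part 1/2:
# the THESES-FREE budget module (decomp-a2c lens-6 «barrier-complement carving», generation 25; critic row 364 (2) remedy: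
# every reusable lemma lives here, imports = Mathlib + Literature only; the thin terminal module
# `Theorems/DeepInfraredEmptinessPlaneWaveCarving.lean` imports this one and concludes the route decl BY NAME).

Contents (all `[folklore]` bookkeeping + one periodic kinetic-budget estimate; no definitions; 0 sorry):
* lattice lemmas on the centred representative `q̃_j ∈ (−K/2, K/2]` of a block wavevector (`crep_injective`, `two_abs_crep_le`,
  `exists_two_abs_ge_of_ne_zero`) and injectivity of the alias map `(q, m) ↦ q̃ + K m` (`aliasMap_injective`);
* `periodicGroundStateEnergy_le_uniform` — `E₀^per(v,N,L) ≤ 16πR·ρ·N` eventually (uniform trial state; R = a range of v);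
* `uvAliasBudget_holds` — **UVB, the periodic UV ALIAS BUDGET of near-minimisers**: for every admissible `v` there is `A > 0`
  (`A = 1/(8(16πR+1))`) such that for `ρ < ρ₀`, eventually in `N`, with `δ = ρN`: every `δ`-near-minimiser and every block
  number `K > 0` with `L/K ≤ 2A/√ρ` satisfy `Σ_{q ∈ (ℤ/K)³} Σ_{m ≠ 0} ⟨e_{q̃+Km}, γ_Ψ e_{q̃+Km}⟩ ≤ N/16`
  (kinetic Chebyshev on the torus: `|q̃+Km|_∞ ≥ K/2` for `m ≠ 0`, `fracDispersion 2 = |p|²`, `T_Ψ ≤ E₀ + δ ≤ (16πR+1)ρN`);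
* free gas (`a = 0`): `periodicGroundStateEnergy_eq_zero_free`, `deepPlaneWaveEmptiness_free(_allConstants)` — the residual
  IRBall `DeepPlaneWaveEmptiness` of part 2 holds at `a = 0` for EVERY `k₀` (all of its content is at `a > 0`).
-/

noncomputable section

namespace Summit.AtomisticToContinuum.BoseEinsteinCondensation.Theorems.DeepInfraredEmptinessPlaneWaveBudget

open Filter MeasureTheory
open scoped ENNReal
open Literature.MathematicalPhysics.QuantumManyBody.BoseGas

/-! ## Lattice lemmas on the centred representative -/

/-- the centred representative is injective on `Fin K`. [folklore] -/
theorem crep_injective (K : ℕ) {a b : Fin K}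
    (h : (if 2 * (a : ℕ) ≤ K then (((a : ℕ) : ℤ)) else (((a : ℕ) : ℤ) - (K : ℤ))) =
      (if 2 * (b : ℕ) ≤ K then (((b : ℕ) : ℤ)) else (((b : ℕ) : ℤ) - (K : ℤ)))) : a = b := by
  have ha := a.isLt
  have hb := b.isLt
  apply Fin.ext
  split_ifs at h <;> omega

/-- `2|q̃| ≤ K`. [folklore] -/
theorem two_abs_crep_le (K : ℕ) (a : Fin K) :
    2 * |((if 2 * (a : ℕ) ≤ K then (((a : ℕ) : ℤ)) else (((a : ℕ) : ℤ) - (K : ℤ))) : ℤ)| ≤ (K : ℤ) := by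
  have ha := a.isLt
  split_ifs with h
  · rw [abs_of_nonneg (by positivity)]; omega
  · rw [abs_of_neg (by omega)]; omega

/-- a higher alias `q̃ + Km`, `m ≠ 0`, has a coordinate with `2|pⱼ| ≥ K`. [folklore] -/
theorem exists_two_abs_ge_of_ne_zero (K : ℕ) (q : Fin 3 → Fin K) {m : Fin 3 → ℤ} (hm : m ≠ 0) :
    ∃ j : Fin 3, (K : ℤ) ≤ 2 * |(if 2 * (q j : ℕ) ≤ K then (((q j : ℕ) : ℤ)) else (((q j : ℕ) : ℤ) - (K : ℤ))) + (K : ℤ) * m j| := by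
  obtain ⟨j, hj⟩ : ∃ j, m j ≠ 0 := by
    by_contra h
    push Not at h
    exact hm (funext h)
  refine ⟨j, ?_⟩
  set c : ℤ := (if 2 * (q j : ℕ) ≤ K then (((q j : ℕ) : ℤ)) else (((q j : ℕ) : ℤ) - (K : ℤ))) with hc
  have h2c : 2 * |c| ≤ (K : ℤ) := two_abs_crep_le K (q j)
  have hK0 : (0 : ℤ) ≤ K := Int.natCast_nonneg K
  have h1 : (K : ℤ) ≤ |(K : ℤ) * m j| := by
    rw [abs_mul, abs_of_nonneg hK0]
    exact le_mul_of_one_le_right hK0 (Int.one_le_abs hj)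
  have h3 : |(K : ℤ) * m j| ≤ |c + (K : ℤ) * m j| + |c| := by
    have := abs_add_le (c + (K : ℤ) * m j) (-c)
    simpa [abs_neg] using this
  linarith

/-! ## UVB is a theorem: the periodic UV alias budget of near-minimisers -/

/-- the alias map `(q, m) ↦ q̃ + Km` is injective on `(ℤ/K)³ × ℤ³`. [folklore] -/
theorem aliasMap_injective (K : ℕ) :
    Function.Injective (fun qm : (Fin 3 → Fin K) × (Fin 3 → ℤ) => fun j : Fin 3 =>
      (if 2 * (qm.1 j : ℕ) ≤ K then (((qm.1 j : ℕ) : ℤ)) else (((qm.1 j : ℕ) : ℤ) - (K : ℤ))) + (K : ℤ) * qm.2 j) := by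
  rintro ⟨q, m⟩ ⟨q', m'⟩ h
  have hj : ∀ j : Fin 3, m j = m' j ∧ q j = q' j := by
    intro j
    have hjj : (if 2 * (q j : ℕ) ≤ K then (((q j : ℕ) : ℤ)) else (((q j : ℕ) : ℤ) - (K : ℤ))) + (K : ℤ) * m j =
        (if 2 * (q' j : ℕ) ≤ K then (((q' j : ℕ) : ℤ)) else (((q' j : ℕ) : ℤ) - (K : ℤ))) + (K : ℤ) * m' j :=
      congr_fun h j
    have hq : ((q j : ℕ) : ℤ) < K := by exact_mod_cast (q j).isLt
    have hq' : ((q' j : ℕ) : ℤ) < K := by exact_mod_cast (q' j).isLt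
    have hq0 : (0 : ℤ) ≤ ((q j : ℕ) : ℤ) := by positivity
    have hq0' : (0 : ℤ) ≤ ((q' j : ℕ) : ℤ) := by positivity
    have hK0 : (0 : ℤ) ≤ K := Int.natCast_nonneg K
    -- the difference of the centred representatives lies in (-K, K)
    have hdiff : |(K : ℤ) * m j - (K : ℤ) * m' j| < K := by
      rw [abs_lt]
      split_ifs at hjj <;> constructor <;> linarith
    have hm : m j = m' j := by
      by_contra hne
      have h1 : (K : ℤ) ≤ |(K : ℤ) * m j - (K : ℤ) * m' j| := by
        rw [← mul_sub, abs_mul, abs_of_nonneg hK0]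
        exact le_mul_of_one_le_right hK0 (Int.one_le_abs (sub_ne_zero.2 hne))
      linarith
    refine ⟨hm, ?_⟩
    rw [hm] at hjj
    exact crep_injective K (add_right_cancel hjj)
  exact Prod.ext (funext fun j => (hj j).2) (funext fun j => (hj j).1)

/-- **UVB holds** (`A = 1/(8(16πR+1))`, `δ = ρN`): kinetic Chebyshev on the alias lattice. [folklore] -/
theorem uvAliasBudget_holds :
    ∀ v : ℝ → ENNReal, IsRepulsiveFiniteRange v → ∃ A : ℝ, 0 < A ∧ ∃ ρ₀ : ℝ, 0 < ρ₀ ∧ ∀ ρ : ℝ, 0 < ρ → ρ < ρ₀ →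
      ∀ᶠ N : ℕ in Filter.atTop, ∃ δ : ENNReal, 0 < δ ∧ ∀ Ψ : PeriodicTrialState N (sideLength ρ N),
        periodicEnergy v Ψ ≤ periodicGroundStateEnergy v N (sideLength ρ N) + δ →
        ∀ K : ℕ, 0 < K → sideLength ρ N / (K : ℝ) ≤ 2 * A / Real.sqrt ρ →
          (∑ q : Fin 3 → Fin K, ∑' m : Fin 3 → ℤ, (if m = 0 then 0 else
            cellOccupation N (sideLength ρ N) (planeWaveMode (sideLength ρ N)
              (fun j => (if 2 * (q j : ℕ) ≤ K then (((q j : ℕ) : ℤ)) else (((q j : ℕ) : ℤ) - (K : ℤ))) + (K : ℤ) * m j)) Ψ.ψ))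
            ≤ ENNReal.ofReal ((N : ℝ) / 16) := by
  intro v hv
  obtain ⟨R, hR, hvR⟩ := hv.exists_pos_range
  obtain ⟨ρ₁, hρ₁, HE⟩ : ∃ ρ₁ : ℝ, 0 < ρ₁ ∧ ∀ ρ : ℝ, 0 < ρ → ρ < ρ₁ → ∀ᶠ N : ℕ in atTop, ∀ v : ℝ → ℝ≥0∞, (∀ r, R < r → v r = 0) → periodicGroundStateEnergy v N (sideLength ρ N) ≤ ENNReal.ofReal (16 * Real.pi * R * ρ * N) := by
    -- inlined (tree twin `Theorems.InfDivGlue.periodicGroundStateEnergy_le_uniform` is farm-unbuilt; a top-level restatement is a dedup)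
    set w : ℝ → ℝ≥0∞ := hardCorePotential (2 * R) with hw
    have hwr : ∀ r, 2 * R < r → w r = 0 := fun r hr => hardCorePotential_of_le hr.le
    have haw : scatteringLength w = ENNReal.ofReal (2 * R) := scatteringLength_hardCorePotential _
    obtain ⟨C, c, hC, hc, H⟩ := LSSY2005_upperBound_periodic_holds w (2 * R)
      (measurable_hardCorePotential _) hwr (by rw [haw]; exact ENNReal.ofReal_ne_top)
    have ha : (scatteringLength w).toReal = 2 * R := by
      rw [haw, ENNReal.toReal_ofReal (by linarith)]
    set c' : ℝ := min c (1 / C) with hc'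
    have hc'pos : 0 < c' := lt_min hc (by positivity)
    set ρ₁ : ℝ := 3 * (c' / (2 * R)) ^ 3 / (4 * Real.pi) with hρ₁
    have hρ₁pos : 0 < ρ₁ := by positivity
    refine ⟨ρ₁, hρ₁pos, fun ρ hρ hρlt => ?_⟩
    filter_upwards [eventually_ge_atTop 2, (tendsto_sideLength_atTop hρ).eventually_gt_atTop (2 * (2 * R))]
      with N hN2 hLR v hvR
    have hN0 : 0 < N := by omega
    have hL : 0 < sideLength ρ N := sideLength_pos_of_pos hρ hN0
    have hρL : (N : ℝ) / sideLength ρ N ^ 3 = ρ := div_sideLength_pow_three hρ hN0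
    generalize sideLength ρ N = L at hL hρL hLR ⊢
    set ρe : ℝ := ((N : ℝ) - 1) / L ^ 3 with hρe
    have hρe_le : ρe ≤ ρ := by
      rw [hρe, ← hρL]
      exact div_le_div_of_nonneg_right (by linarith) (by positivity)
    have hρe_pos : 0 < ρe := by
      rw [hρe]
      have : (2 : ℝ) ≤ N := by exact_mod_cast hN2
      exact div_pos (by linarith) (by positivity)
    have hx_pos : 0 < 4 * Real.pi * ρe / 3 := by positivity
    have hab_eq : (2 * R) / (4 * Real.pi * ρe / 3) ^ (-(1 : ℝ) / 3) =
        2 * R * (4 * Real.pi * ρe / 3) ^ ((1 : ℝ) / 3) := by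
      rw [show (-(1 : ℝ) / 3) = -(1 / 3) by norm_num, Real.rpow_neg hx_pos.le, div_inv_eq_mul]
    have hab_lt : 2 * R * (4 * Real.pi * ρe / 3) ^ ((1 : ℝ) / 3) < c' := by
      have h1 : (4 * Real.pi * ρe / 3) ^ ((1 : ℝ) / 3) ≤ (4 * Real.pi * ρ / 3) ^ ((1 : ℝ) / 3) :=
        Real.rpow_le_rpow hx_pos.le (by gcongr) (by norm_num)
      have h2 : (4 * Real.pi * ρ / 3) ^ ((1 : ℝ) / 3) < (4 * Real.pi * ρ₁ / 3) ^ ((1 : ℝ) / 3) :=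
        Real.rpow_lt_rpow (by positivity) (by gcongr) (by norm_num)
      have h3 : (4 * Real.pi * ρ₁ / 3) ^ ((1 : ℝ) / 3) = c' / (2 * R) := by
        rw [hρ₁]
        have : 4 * Real.pi * (3 * (c' / (2 * R)) ^ 3 / (4 * Real.pi)) / 3 = (c' / (2 * R)) ^ 3 := by
          field_simp
        rw [this, show ((1 : ℝ) / 3) = ((3 : ℕ) : ℝ)⁻¹ by norm_num,
          Real.pow_rpow_inv_natCast (by positivity) three_ne_zero]
      calc 2 * R * (4 * Real.pi * ρe / 3) ^ ((1 : ℝ) / 3)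
          < 2 * R * (c' / (2 * R)) := by
            apply mul_lt_mul_of_pos_left (h1.trans_lt (h2.trans_eq h3)) (by linarith)
        _ = c' := by field_simp
    have hab_c : (2 * R) / (4 * Real.pi * ρe / 3) ^ (-(1 : ℝ) / 3) ≤ c := by
      rw [hab_eq]; exact (hab_lt.le.trans (min_le_left _ _))
    have hab_C : C * ((2 * R) / (4 * Real.pi * ρe / 3) ^ (-(1 : ℝ) / 3)) ≤ 1 := by
      rw [hab_eq]
      have h1 : 2 * R * (4 * Real.pi * ρe / 3) ^ ((1 : ℝ) / 3) ≤ 1 / C :=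
        hab_lt.le.trans (min_le_right _ _)
      calc C * (2 * R * (4 * Real.pi * ρe / 3) ^ ((1 : ℝ) / 3)) ≤ C * (1 / C) :=
            mul_le_mul_of_nonneg_left h1 hC.le
        _ = 1 := by field_simp
    have hU := H N L hN2 hL (by linarith)
    simp only at hU
    rw [ha] at hU
    have hU' := hU hab_c
    calc periodicGroundStateEnergy v N L
        ≤ periodicGroundStateEnergy w N L :=
          periodicGroundStateEnergy_mono_of_le (le_hardCorePotential_two_mul hR hvR)
      _ ≤ ENNReal.ofReal (4 * Real.pi * ρe * (2 * R) *
            (1 + C * ((2 * R) / (4 * Real.pi * ρe / 3) ^ (-(1 : ℝ) / 3))) * N) := hU'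
      _ ≤ ENNReal.ofReal (16 * Real.pi * R * ρ * N) := by
          apply ENNReal.ofReal_le_ofReal
          have hN' : (0 : ℝ) ≤ N := N.cast_nonneg
          have h1 : 1 + C * ((2 * R) / (4 * Real.pi * ρe / 3) ^ (-(1 : ℝ) / 3)) ≤ 2 := by linarith
          have h0 : 0 ≤ 1 + C * ((2 * R) / (4 * Real.pi * ρe / 3) ^ (-(1 : ℝ) / 3)) := by
            rw [hab_eq]; positivity
          calc 4 * Real.pi * ρe * (2 * R) * (1 + C * ((2 * R) / (4 * Real.pi * ρe / 3) ^ (-(1 : ℝ) / 3))) * N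
              ≤ 4 * Real.pi * ρ * (2 * R) * 2 * N := by
                gcongr
            _ = 16 * Real.pi * R * ρ * N := by ring
  set CT : ℝ := 16 * Real.pi * R + 1 with hCT
  have hCT1 : 1 ≤ CT := by
    have h16 : (0 : ℝ) ≤ 16 * Real.pi * R := by positivity
    linarith [hCT]
  have hCTpos : 0 < CT := by linarith
  refine ⟨1 / (8 * CT), by positivity, ρ₁, hρ₁, fun ρ hρ hρ1 => ?_⟩
  filter_upwards [HE ρ hρ hρ1, eventually_gt_atTop 0] with N hEN hN0
  have hNr : (0 : ℝ) < N := Nat.cast_pos.2 hN0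
  have hL : 0 < sideLength ρ N := sideLength_pos_of_pos hρ hN0
  refine ⟨ENNReal.ofReal (ρ * N), by rw [ENNReal.ofReal_pos]; positivity, ?_⟩
  have hE0 := hEN v hvR
  generalize sideLength ρ N = L at hL hE0 ⊢
  intro Ψ hΨ K hK hwin
  have hKr : (0 : ℝ) < K := Nat.cast_pos.2 hK
  have hsρ : 0 < Real.sqrt ρ := Real.sqrt_pos.2 hρ
  classical
  -- (1) kinetic budget `T ≤ CT ρ N`
  have hT : (∫⁻ X in cellN N L, kineticDensity Ψ.ψ X) ≤ ENNReal.ofReal (CT * ρ * N) :=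
    calc (∫⁻ X in cellN N L, kineticDensity Ψ.ψ X) ≤ periodicEnergy v Ψ :=
          lintegral_kineticDensity_le_periodicEnergy v Ψ
      _ ≤ periodicGroundStateEnergy v N L + ENNReal.ofReal (ρ * N) := hΨ
      _ ≤ ENNReal.ofReal (16 * Real.pi * R * ρ * N) + ENNReal.ofReal (ρ * N) := add_le_add hE0 le_rfl
      _ = ENNReal.ofReal (CT * ρ * N) := by
          rw [← ENNReal.ofReal_add (by positivity) (by positivity)]
          congr 1
          rw [hCT]; ring
  -- (2) the UV indicator sum: `g p = n(e_p)` if `2|p_j| ≥ K` for some `j`, else `0`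
  set g : (Fin 3 → ℤ) → ℝ≥0∞ := fun p => if (∃ j : Fin 3, (K : ℤ) ≤ 2 * |p j|) then
    cellOccupation N L (planeWaveMode L p) Ψ.ψ else 0 with hg
  -- (3) Chebyshev: `ofReal(π²K²/L²) · Σ' g ≤ Σ' |k_p|² n(e_p) = T`
  have hcheb : ENNReal.ofReal (Real.pi ^ 2 * (K : ℝ) ^ 2 / L ^ 2) * (∑' p : Fin 3 → ℤ, g p) ≤
      ENNReal.ofReal (CT * ρ * N) := by
    rw [← ENNReal.tsum_mul_left]
    refine le_trans (ENNReal.tsum_le_tsum fun p => ?_) ((tsum_fracDispersion_two_mul_cellOccupation hL Ψ).le.trans hT)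
    by_cases hp : ∃ j : Fin 3, (K : ℤ) ≤ 2 * |p j|
    · rw [hg]; simp only [hp, if_true]
      gcongr
      rw [fracDispersion_two]
      apply ENNReal.ofReal_le_ofReal
      obtain ⟨j, hj⟩ := hp
      have hjr : (K : ℝ) ≤ 2 * |((p j : ℤ) : ℝ)| := by exact_mod_cast hj
      have h1 : (K : ℝ) ^ 2 ≤ 4 * ((p j : ℤ) : ℝ) ^ 2 := by nlinarith [sq_abs ((p j : ℤ) : ℝ), abs_nonneg ((p j : ℤ) : ℝ)]
      have h2 : ((p j : ℤ) : ℝ) ^ 2 ≤ ∑ k : Fin 3, ((p k : ℤ) : ℝ) ^ 2 :=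
        Finset.single_le_sum (f := fun k : Fin 3 => ((p k : ℤ) : ℝ) ^ 2) (fun k _ => sq_nonneg _) (Finset.mem_univ j)
      rw [div_le_div_iff_of_pos_right (by positivity)]
      nlinarith [Real.pi_pos]
    · rw [hg]; simp only [hp, if_false, mul_zero]; exact bot_le
  have hsum : (∑' p : Fin 3 → ℤ, g p) ≤ ENNReal.ofReal (L ^ 2 / (Real.pi ^ 2 * (K : ℝ) ^ 2)) * ENNReal.ofReal (CT * ρ * N) := by
    have hapos : 0 < Real.pi ^ 2 * (K : ℝ) ^ 2 / L ^ 2 := by positivity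
    have ha0 : ENNReal.ofReal (Real.pi ^ 2 * (K : ℝ) ^ 2 / L ^ 2) ≠ 0 := by
      rw [ne_eq, ENNReal.ofReal_eq_zero, not_le]; exact hapos
    calc (∑' p : Fin 3 → ℤ, g p)
        = (ENNReal.ofReal (Real.pi ^ 2 * (K : ℝ) ^ 2 / L ^ 2))⁻¹ *
            (ENNReal.ofReal (Real.pi ^ 2 * (K : ℝ) ^ 2 / L ^ 2) * (∑' p : Fin 3 → ℤ, g p)) := by
          rw [← mul_assoc, ENNReal.inv_mul_cancel ha0 ENNReal.ofReal_ne_top, one_mul]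
      _ ≤ (ENNReal.ofReal (Real.pi ^ 2 * (K : ℝ) ^ 2 / L ^ 2))⁻¹ * ENNReal.ofReal (CT * ρ * N) := by gcongr
      _ = ENNReal.ofReal (L ^ 2 / (Real.pi ^ 2 * (K : ℝ) ^ 2)) * ENNReal.ofReal (CT * ρ * N) := by
          rw [← ENNReal.ofReal_inv_of_pos hapos, inv_div]
  -- (4) the alias double sum is dominated by `Σ' g` (injective alias map; higher aliases are UV)
  have halias : (∑ q : Fin 3 → Fin K, ∑' m : Fin 3 → ℤ, (if m = 0 then 0 else
      cellOccupation N L (planeWaveMode L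
        (fun j => (if 2 * (q j : ℕ) ≤ K then (((q j : ℕ) : ℤ)) else (((q j : ℕ) : ℤ) - (K : ℤ))) + (K : ℤ) * m j)) Ψ.ψ))
      ≤ ∑' p : Fin 3 → ℤ, g p := by
    calc (∑ q : Fin 3 → Fin K, ∑' m : Fin 3 → ℤ, (if m = 0 then 0 else
          cellOccupation N L (planeWaveMode L
            (fun j => (if 2 * (q j : ℕ) ≤ K then (((q j : ℕ) : ℤ)) else (((q j : ℕ) : ℤ) - (K : ℤ))) + (K : ℤ) * m j)) Ψ.ψ))
        ≤ ∑ q : Fin 3 → Fin K, ∑' m : Fin 3 → ℤ, g (fun j => (if 2 * (q j : ℕ) ≤ K then (((q j : ℕ) : ℤ)) else (((q j : ℕ) : ℤ) - (K : ℤ))) + (K : ℤ) * m j) := by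
          refine Finset.sum_le_sum fun q _ => ENNReal.tsum_le_tsum fun m => ?_
          by_cases hm : m = 0
          · simp [hm]
          · rw [if_neg hm, hg]
            simp only [exists_two_abs_ge_of_ne_zero K q hm, if_true]
            exact le_rfl
      _ = ∑' qm : (Fin 3 → Fin K) × (Fin 3 → ℤ), g (fun j => (if 2 * (qm.1 j : ℕ) ≤ K then (((qm.1 j : ℕ) : ℤ)) else (((qm.1 j : ℕ) : ℤ) - (K : ℤ))) + (K : ℤ) * qm.2 j) := by
          rw [ENNReal.tsum_prod', tsum_fintype]
      _ ≤ ∑' p : Fin 3 → ℤ, g p := ENNReal.tsum_comp_le_tsum_of_injective (aliasMap_injective K) g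
  -- (5) arithmetic: `L²/(π²K²) · CT ρ N ≤ N/16` from `L/K ≤ 2A/√ρ`, `A = 1/(8 CT)`
  refine halias.trans (hsum.trans ?_)
  rw [← ENNReal.ofReal_mul (by positivity)]
  apply ENNReal.ofReal_le_ofReal
  have hLK : L / (K : ℝ) ≤ 2 * (1 / (8 * CT)) / Real.sqrt ρ := hwin
  have hLK0 : 0 ≤ L / (K : ℝ) := by positivity
  have hsq : (L / (K : ℝ)) ^ 2 ≤ (2 * (1 / (8 * CT)) / Real.sqrt ρ) ^ 2 := pow_le_pow_left₀ hLK0 hLK 2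
  have hρsq : Real.sqrt ρ ^ 2 = ρ := Real.sq_sqrt hρ.le
  have e1 : L ^ 2 / (Real.pi ^ 2 * (K : ℝ) ^ 2) * (CT * ρ * N) = (L / (K : ℝ)) ^ 2 * (CT * ρ * N) / Real.pi ^ 2 := by
    field_simp
  have e2 : (2 * (1 / (8 * CT)) / Real.sqrt ρ) ^ 2 * (CT * ρ * N) = N / (16 * CT) := by
    rw [div_pow, hρsq]
    field_simp
    ring
  have hpi : (1 : ℝ) ≤ Real.pi ^ 2 := by nlinarith [Real.pi_gt_three]
  calc L ^ 2 / (Real.pi ^ 2 * (K : ℝ) ^ 2) * (CT * ρ * N)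
      = (L / (K : ℝ)) ^ 2 * (CT * ρ * N) / Real.pi ^ 2 := e1
    _ ≤ (2 * (1 / (8 * CT)) / Real.sqrt ρ) ^ 2 * (CT * ρ * N) / Real.pi ^ 2 := by gcongr
    _ = N / (16 * CT) / Real.pi ^ 2 := by rw [e2]
    _ ≤ N / (16 * CT) / 1 := by gcongr
    _ ≤ (N : ℝ) / 16 := by
        rw [div_one, div_le_div_iff_of_pos_left hNr (by positivity) (by norm_num)]
        linarith

/-! ## Free gas: IRBall holds for EVERY `k₀` (indeed for every finite set of non-zero momenta) -/

/-- **IRBall in the free gas, all constants**: for admissible `v` with `a = 0`, every `ρ > 0`, eventually in `N`, with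
`δ_N = N/(16 C_P L_N²)`: every finite set of non-zero momenta carries `≤ N/16` in every `δ_N`-near-minimiser
(`Σ_{p ≠ 0} n(e_p) = N − n₀ ≤ C_P L² ⟨Ψ,HΨ⟩`). [folklore] -/
theorem deepPlaneWaveEmptiness_free_allConstants {v : ℝ → ℝ≥0∞} (hv : IsRepulsiveFiniteRange v)
    (ha : scatteringLength v = 0) (ρ : ℝ) (hρ : 0 < ρ) :
    ∀ᶠ N : ℕ in Filter.atTop, ∃ δ : ENNReal, 0 < δ ∧ ∀ Ψ : PeriodicTrialState N (sideLength ρ N),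
      periodicEnergy v Ψ ≤ periodicGroundStateEnergy v N (sideLength ρ N) + δ →
      ∀ S : Finset (Fin 3 → ℤ), (∀ p ∈ S, p ≠ 0) →
        ∑ p ∈ S, cellOccupation N (sideLength ρ N) (planeWaveMode (sideLength ρ N) p) Ψ.ψ ≤ ENNReal.ofReal ((N : ℝ) / 16) := by
  obtain ⟨R₀, hE⟩ : ∃ R₀ : ℝ, ∀ (N : ℕ) (L : ℝ), 2 ≤ N → 0 < L → 2 * R₀ < L →
      periodicGroundStateEnergy v N L = 0 := by
    -- inlined (the tree twin `Theorems.periodicGroundStateEnergy_eq_zero_of_scatteringLength_eq_zero` lives in a Theses-importing module)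
    have hvc := hv
    obtain ⟨hmeas, R₀, hR⟩ := hvc
    obtain ⟨C, c, _, hc, h⟩ :=
      LSSY2005_upperBound_periodic_holds v R₀ hmeas hR (by rw [ha]; exact ENNReal.zero_ne_top)
    refine ⟨R₀, fun N L hN hL hRL => ?_⟩
    have key := h N L hN hL hRL
    simp only [ha, ENNReal.toReal_zero, zero_div, mul_zero, zero_mul, ENNReal.ofReal_zero,
      nonpos_iff_eq_zero] at key
    exact key hc.le
  obtain ⟨C, hC, hdep⟩ := Literature.Barriers.AtomisticToContinuum.BoseGas.natCast_le_condensateOccupation_add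
  filter_upwards [eventually_gt_atTop 1, (tendsto_sideLength_atTop hρ).eventually_gt_atTop (2 * R₀)] with N hN hNR
  have hN0 : 0 < N := lt_trans zero_lt_one hN
  have hNr : (0 : ℝ) < N := Nat.cast_pos.2 hN0
  have hL : 0 < sideLength ρ N := sideLength_pos_of_pos hρ hN0
  refine ⟨ENNReal.ofReal ((N : ℝ) / (16 * (C * sideLength ρ N ^ 2))), by rw [ENNReal.ofReal_pos]; positivity, ?_⟩
  generalize sideLength ρ N = L at hL hNR ⊢
  intro Ψ hΨ S hS
  rw [hE N L hN hL hNR, zero_add] at hΨ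
  classical
  have h0S : (0 : Fin 3 → ℤ) ∉ S := fun h => (hS 0 h) rfl
  -- Σ_{p ∈ S} n(e_p) + n₀ ≤ N
  have h1 : (∑ p ∈ S, cellOccupation N L (planeWaveMode L p) Ψ.ψ) + condensateOccupation N L Ψ.ψ ≤ (N : ℝ≥0∞) := by
    rw [← cellOccupation_planeWaveMode_zero, ← Ψ.tsum_cellOccupation_planeWaveMode hL]
    calc (∑ p ∈ S, cellOccupation N L (planeWaveMode L p) Ψ.ψ) + cellOccupation N L (planeWaveMode L 0) Ψ.ψ
        = ∑ p ∈ insert (0 : Fin 3 → ℤ) S, cellOccupation N L (planeWaveMode L p) Ψ.ψ := by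
          rw [Finset.sum_insert h0S, add_comm]
      _ ≤ ∑' p : Fin 3 → ℤ, cellOccupation N L (planeWaveMode L p) Ψ.ψ := ENNReal.sum_le_tsum _
  -- N ≤ n₀ + C L² E ≤ n₀ + N/16
  have h2 : (N : ℝ≥0∞) ≤ condensateOccupation N L Ψ.ψ + ENNReal.ofReal ((N : ℝ) / 16) := by
    refine (hdep N L hN hL v Ψ).trans (add_le_add le_rfl ?_)
    calc ENNReal.ofReal (C * L ^ 2) * periodicEnergy v Ψ
        ≤ ENNReal.ofReal (C * L ^ 2) * ENNReal.ofReal ((N : ℝ) / (16 * (C * L ^ 2))) := by gcongr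
      _ = ENNReal.ofReal ((N : ℝ) / 16) := by
          rw [← ENNReal.ofReal_mul (by positivity)]
          congr 1
          field_simp
  have hn0 : condensateOccupation N L Ψ.ψ ≠ ⊤ :=
    ne_top_of_le_ne_top (ENNReal.natCast_ne_top N) (le_trans le_add_self h1)
  have h3 := h1.trans h2
  rw [add_comm (condensateOccupation N L Ψ.ψ)] at h3
  exact (ENNReal.add_le_add_iff_right hn0).1 h3

/-- **IRBall's registered shape at `a = 0`** (`k₀ = ρ₀ = 1`). [folklore] -/
theorem deepPlaneWaveEmptiness_free :
    ∀ v : ℝ → ENNReal, IsRepulsiveFiniteRange v → scatteringLength v = 0 → ∃ k₀ : ℝ, 0 < k₀ ∧ ∃ ρ₀ : ℝ, 0 < ρ₀ ∧ ∀ ρ : ℝ, 0 < ρ → ρ < ρ₀ →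
    ∀ᶠ N : ℕ in Filter.atTop, ∃ δ : ENNReal, 0 < δ ∧ ∀ Ψ : PeriodicTrialState N (sideLength ρ N),
      periodicEnergy v Ψ ≤ periodicGroundStateEnergy v N (sideLength ρ N) + δ →
      ∀ S : Finset (Fin 3 → ℤ),
        (∀ p ∈ S, p ≠ 0 ∧ ∀ j : Fin 3, 2 * Real.pi * |((p j : ℤ) : ℝ)| / sideLength ρ N < k₀ * Real.sqrt ρ) →
        ∑ p ∈ S, cellOccupation N (sideLength ρ N) (planeWaveMode (sideLength ρ N) p) Ψ.ψ ≤ ENNReal.ofReal ((N : ℝ) / 16) := by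
  intro v hv ha
  refine ⟨1, one_pos, 1, one_pos, fun ρ hρ _ => ?_⟩
  filter_upwards [deepPlaneWaveEmptiness_free_allConstants hv ha ρ hρ] with N hN
  obtain ⟨δ, hδ, H⟩ := hN
  exact ⟨δ, hδ, fun Ψ hΨ S hS => H Ψ hΨ S fun p hp => (hS p hp).1⟩

end Summit.AtomisticToContinuum.BoseEinsteinCondensation.Theorems.DeepInfraredEmptinessPlaneWaveBudget

end
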